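import Mathlib
import Summits.Ventures.PercRepro.PuncturedLYMUnif33Table
import Summits.Ventures.PercRepro.PuncturedLYMUnif33Pos1

/-!
# PercRepro — (SP) FOR ANY NUMBER OF PAIRWISE DISJOINT `3`-SETS AT LEVEL `3`: POSITIVITY OF THE TABLE
(p10, gen 40)

The positivity of the denominators `Qp`, `Pp` and of `Yc`, `Pc` for `n ≥ 4`, `3k ≤ n`; `sel_nonneg` (by the class guards) and `raw_nonneg`.  Nothing here asserts (SP).
-/

namespace PercRepro.PuncturedLYM.Split.TypeLift.Unif33

/-- `Qp > 0` for `n ≥ 4`, `k ∈ {0} ∪ [1, ∞)`, `3k ≤ n`: `Qp` is linear in `k`, `Qp · n = (n − 3k) A + k (3A + nB)` with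
`A = Qp(n, 0)` and `3A + nB` positive for `n ≥ 4`. -/
theorem Qp_pos (n k : ℚ) (hn : 4 ≤ n) (hk1 : k = 0 ∨ 1 ≤ k) (hk : 3 * k ≤ n) : 0 < Qp n k := by
  obtain ⟨n', hn', rfl⟩ : ∃ n', 0 ≤ n' ∧ n = 4 + n' := ⟨n - 4, by linarith, by ring⟩
  have hA : 0 < 3 * n' + 11 := by positivity
  have hC : 0 < 9 * n' + 33 := by positivity
  have key : Qp (4 + n') k * (4 + n') = ((4 + n') - 3 * k) * (3 * n' + 11) +
      k * (9 * n' + 33) := by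
    unfold Qp; ring
  have hprod : 0 < Qp (4 + n') k * (4 + n') := by
    rw [key]
    have h1 : 0 ≤ ((4 + n') - 3 * k) * (3 * n' + 11) := mul_nonneg (by linarith) hA.le
    rcases hk1 with rfl | hk1
    · nlinarith
    · have h2 : (9 * n' + 33) ≤ k * (9 * n' + 33) := le_mul_of_one_le_left hC.le hk1
      linarith
  have hn0 : (0 : ℚ) < 4 + n' := by linarith
  by_contra hneg
  have hle := not_lt.1 hneg
  nlinarith [mul_nonneg (neg_nonneg.2 hle) hn0.le]

/-- `Pp > 0` for `n ≥ 4`, `3k ≤ n`. -/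
theorem Pp_pos (n k : ℚ) (hn : 4 ≤ n) (hk : 3 * k ≤ n) : 0 < Pp n k := by
  obtain ⟨n', hn', rfl⟩ : ∃ n', 0 ≤ n' ∧ n = 4 + n' := ⟨n - 4, by linarith, by ring⟩
  have h : Pp (4 + n') k = (4 + n') * (n' ^ 2 + 5 * n' + 4) - 6 * (k - (4 + n') / 3) := by
    unfold Pp; ring
  have h2 : 0 < (4 + n') * (n' ^ 2 + 5 * n' + 4) := by positivity
  rw [h]
  nlinarith

/-- `Yc > 0` for `n ≥ 4`. -/
theorem Yc_pos (n : ℚ) (hn : 4 ≤ n) : 0 < Yc n := by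
  obtain ⟨n', hn', rfl⟩ : ∃ n', 0 ≤ n' ∧ n = 4 + n' := ⟨n - 4, by linarith, by ring⟩
  have h : Yc (4 + n') = (1 / 24) * n' ^ 4 + (5 / 12) * n' ^ 3 + (35 / 24) * n' ^ 2 + (25 / 12) * n' + 1 := by unfold Yc; ring
  rw [h]; positivity

/-- `Pc = Pp / 6`. -/
theorem Pc_eq (n k : ℚ) : Pc n k = Pp n k / 6 := by unfold Pc Pp; ring

/-- `Pc > 0` for `n ≥ 4`, `3k ≤ n`. -/
theorem Pc_pos (n k : ℚ) (hn : 4 ≤ n) (hk : 3 * k ≤ n) : 0 < Pc n k := by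
  rw [Pc_eq]
  have h2 := Pp_pos n k hn hk
  positivity

/-- The class `(0, 0)`: every direction's numerator is nonnegative on the class. -/
theorem sel_00_nonneg (n k : ℚ) (v : ℕ) (hn : 4 ≤ n) (hk1 : k = 0 ∨ 1 ≤ k) (hk : 0 ≤ k) (hf : 3 ≤ n - 3 * k) : 0 ≤ sel_00 v n k := by
  unfold sel_00
  split_ifs with h1 h2
  · exact N_00_D0_nonneg n k (by rcases hk1 with h | h <;> linarith) hk1 hn hf
  · exact N_00_F_nonneg n k (by rcases hk1 with h | h <;> linarith) hk1 hn hf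
  · exact le_refl 0

/-- The class `(1, 0)`: every direction's numerator is nonnegative on the class. -/
theorem sel_10_nonneg (n k : ℚ) (v : ℕ) (hk : 1 ≤ k) (hf : 2 ≤ n - 3 * k) : 0 ≤ sel_10 v n k := by
  unfold sel_10
  split_ifs with h1 h2 h3
  · exact N_10_D0_nonneg n k hk hf
  · exact N_10_D1_nonneg n k hk hf
  · exact N_10_F_nonneg n k hk hf
  · exact le_refl 0

/-- The class `(0, 1)`: every direction's numerator is nonnegative on the class. -/
theorem sel_01_nonneg (n k : ℚ) (v : ℕ) (hk : 1 ≤ k) (hf : 1 ≤ n - 3 * k) : 0 ≤ sel_01 v n k := by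
  unfold sel_01
  split_ifs with h1 h2
  · exact N_01_D0_nonneg n k hk hf
  · exact N_01_F_nonneg n k hk hf
  · exact le_refl 0

/-- The class `(2, 0)`: every direction's numerator is nonnegative on the class. -/
theorem sel_20_nonneg (n k : ℚ) (v : ℕ) (hk : 2 ≤ k) (hf : 1 ≤ n - 3 * k) : 0 ≤ sel_20 v n k := by
  unfold sel_20
  split_ifs with h1 h2 h3
  · exact N_20_D0_nonneg n k hk hf
  · exact N_20_D1_nonneg n k hk hf
  · exact N_20_F_nonneg n k hk hf
  · exact le_refl 0

/-- The class `(1, 1)`: every direction's numerator is nonnegative on the class. -/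
theorem sel_11_nonneg (n k : ℚ) (v : ℕ) (hk : 2 ≤ k) (hf : 0 ≤ n - 3 * k) : 0 ≤ sel_11 v n k := by
  unfold sel_11
  split_ifs with h1 h2 h3
  · exact N_11_D0_nonneg n k hk hf
  · exact N_11_D1_nonneg n k hk hf
  · exact N_11_F_nonneg n k hk hf
  · exact le_refl 0

/-- The class `(3, 0)`: every direction's numerator is nonnegative on the class. -/
theorem sel_30_nonneg (n k : ℚ) (v : ℕ) (hk : 3 ≤ k) (hf : 0 ≤ n - 3 * k) : 0 ≤ sel_30 v n k := by
  unfold sel_30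
  split_ifs with h1 h2 h3
  · exact N_30_D0_nonneg n k hk hf
  · exact N_30_D1_nonneg n k hk hf
  · exact N_30_F_nonneg n k hk hf
  · exact le_refl 0

/-- Every numerator of the table is nonnegative on its class. -/
theorem sel_nonneg (n k : ℚ) (c1 c2 v : ℕ) (hn : 4 ≤ n) (hk1 : k = 0 ∨ 1 ≤ k) (hk : (c1 : ℚ) + c2 ≤ k)
    (hf : (3 : ℚ) - c1 - 2 * c2 ≤ n - 3 * k) : 0 ≤ sel c1 c2 v n k := by
  unfold sel
  by_cases g1 : c1 = 0 ∧ c2 = 0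
  · rw [if_pos g1]
    obtain ⟨rfl, rfl⟩ := g1
    exact sel_00_nonneg n k v hn hk1 (by push_cast at hk; linarith) (by push_cast at hf; linarith)
  rw [if_neg g1]
  by_cases g2 : c1 = 1 ∧ c2 = 0
  · rw [if_pos g2]
    obtain ⟨rfl, rfl⟩ := g2
    exact sel_10_nonneg n k v (by push_cast at hk; linarith) (by push_cast at hf; linarith)
  rw [if_neg g2]
  by_cases g3 : c1 = 0 ∧ c2 = 1
  · rw [if_pos g3]
    obtain ⟨rfl, rfl⟩ := g3
    exact sel_01_nonneg n k v (by push_cast at hk; linarith) (by push_cast at hf; linarith)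
  rw [if_neg g3]
  by_cases g4 : c1 = 2 ∧ c2 = 0
  · rw [if_pos g4]
    obtain ⟨rfl, rfl⟩ := g4
    exact sel_20_nonneg n k v (by push_cast at hk; linarith) (by push_cast at hf; linarith)
  rw [if_neg g4]
  by_cases g5 : c1 = 1 ∧ c2 = 1
  · rw [if_pos g5]
    obtain ⟨rfl, rfl⟩ := g5
    exact sel_11_nonneg n k v (by push_cast at hk; linarith) (by push_cast at hf; linarith)
  rw [if_neg g5]
  by_cases g6 : c1 = 3 ∧ c2 = 0
  · rw [if_pos g6]
    obtain ⟨rfl, rfl⟩ := g6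
    exact sel_30_nonneg n k v (by push_cast at hk; linarith) (by push_cast at hf; linarith)
  rw [if_neg g6]

/-- The unnormalised weights are nonnegative on their classes. -/
theorem raw_nonneg (n k : ℚ) (c1 c2 v : ℕ) (hn : 4 ≤ n) (hk3 : 3 * k ≤ n) (hk1 : k = 0 ∨ 1 ≤ k)
    (hk : (c1 : ℚ) + c2 ≤ k) (hf : (3 : ℚ) - c1 - 2 * c2 ≤ n - 3 * k) : 0 ≤ raw n k c1 c2 v := by
  unfold raw
  have hQ := Qp_pos n k hn hk1 hk3
  have hP := Pp_pos n k hn hk3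
  exact div_nonneg (sel_nonneg n k c1 c2 v hn hk1 hk hf) (by positivity)

end PercRepro.PuncturedLYM.Split.TypeLift.Unif33
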